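import Mathlib
import Summits.CriticalPhenomena.PercolationContinuityZ3.Theorems.PercNearOneGluingNoHeavyLowerTailOrientedAntipodalHallTwoSidedCertificateCoInt
import Summits.CriticalPhenomena.PercolationContinuityZ3.Theorems.PercNearOneGluingNoHeavyLowerTailOrientedAntipodalHallCoIntStarAcyclic

/-!
# CoI-Kleitman for 'bipartite + acyclic on one side' type digraphs (any number of petals)

Helper file for crux `stmt-CriticalPhenomena-4575` (`NoHeavyLowerTail`, route `PercNearOneGluingNoHeavy`), hull-port seat
`prim-hp-7` (generation 54); `--supports stmt-CriticalPhenomena-4575`.  Everything here is PROVED.  Setting of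
`…OrientedAntipodalHall`: `f : Finset α → Lab k` monotone, ground set `S`, antipodal bads `X ⊆ S` of type `(i X, j X)`, goods
`U ⊆ S` (`f U = A`, `f (S \ U) = B`).

**Theorem (`exists_injective_good_above_of_coint_bipartiteAcyclic`).**  Split the petals into a set `P` and its complement
`Q`, and fix weights `σ`.  Let `D` be a CO-INTERSECTING family of antipodal bads whose every type `(i X, j X)` is either an
arc between `P` and `Q` (in either direction; opposite pairs allowed) or an arc inside `Q` going up in `σ`; no type lies
inside `P`.  Then the bads of `D` have DISTINCT good representatives above them.  With `P = {v}` this is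
`exists_injective_good_above_of_coint_starAcyclic` (file `…CoIntStarAcyclic`); with no arcs inside `Q` it is the bipartite
case (prim-hp-7 gen 50); it contains every certified class found by the exhaustive label-level search on four petals (the two
maximal classes `M1` — `P = {0}` — and `M2 = {01,10,03,30,12,21,23,32,02}` — `P = {1,3}`, the chord `0→2` inside `Q` —, file
`…TwoSidedCertificateCoIntInstances`), prim-ineq-gen-3's cyclic triangle and their four tournaments on four petals
(`TT₄`, strong, `C₃`+source, `C₃`+sink: take `P = {0}`, `{0}`, `{1}`, `{2}`), the directed 4- and 5-cycles.

**Proof** = one label-level certificate for the co-intersecting table theorem `exists_injective_good_above_of_twoSidedCertCoInt`: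
members PLAIN for the arcs `P → Q`, COMPLEMENTED otherwise; pseudo-classes `Φ_s`, `s ∈ Q`; ranks `σ (head)` for the arcs inside
`Q` and for `Φ`, then `N` for the complemented `Q → P` arcs, then `N + 1` for the plain ones.  Co-intersection enters through
injectivity of the member map and through a complemented `(q,p)` preceding a plain `(p,q)`.  The certificate conditions were
checked literally for ALL 498 276 pairs (type set, `P`) on `≤ 5` petals (`prim-hp-7/code/gen54/lab54/bda.py`): 0 failures.
(prim-hp-7 gen 54, 2026-08-22; memo `prim-hp-7/FROM-prim-hp-7-g54-THREE-PETALS.md`.)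
-/

namespace Summit.CriticalPhenomena.PercolationContinuityZ3.Theorems

namespace OrientedAntipodalHall

open Finset AntipodalStrongHarris AntipodalStrongHarris.Lab
open scoped FinsetFamily

variable {α : Type*} [DecidableEq α] {k : ℕ}

/-- **CoI-Kleitman for the class 'bipartite + acyclic on one side'.**  `f` monotone; `P` a set of petals, `σ` weights; `D` a
co-intersecting family of antipodal bads of `S` whose every type `(i X, j X)` has (`i X ∈ P`, `j X ∉ P`) or (`i X ∉ P`,
`j X ∈ P`) or (`i X ∉ P`, `j X ∉ P`, `σ (i X) < σ (j X)`).  Then there is an injective `φ` on `D` with `X ⊆ φ X ⊆ S`,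
`f (φ X) = A`, `f (S \ φ X) = B`. [this work] -/
theorem exists_injective_good_above_of_coint_bipartiteAcyclic (S : Finset α) {f : Finset α → Lab k}
    (hf : ∀ ⦃X Y : Finset α⦄, X ⊆ Y → f X ≤ f Y) (D : Finset (Finset α)) (i j : Finset α → Fin k)
    (hDS : ∀ X ∈ D, X ⊆ S) (hDi : ∀ X ∈ D, f X = petal (i X)) (hDj : ∀ X ∈ D, f (S \ X) = petal (j X))
    (P : Finset (Fin k)) (σ : Fin k → ℕ)
    (hT : ∀ X ∈ D, (i X ∈ P ∧ j X ∉ P) ∨ (i X ∉ P ∧ j X ∈ P) ∨ (i X ∉ P ∧ j X ∉ P ∧ σ (i X) < σ (j X)))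
    (hco : ∀ X ∈ D, ∀ X' ∈ D, X ∪ X' ≠ S) :
    ∃ φ : D → Finset α, Function.Injective φ ∧
      ∀ X : D, (X : Finset α) ⊆ φ X ∧ φ X ⊆ S ∧ f (φ X) = top ∧ f (S \ φ X) = bot := by
  classical
  have hij : ∀ X ∈ D, i X ≠ j X := by
    intro X hX h
    rcases hT X hX with ⟨h1, h2⟩ | ⟨h1, h2⟩ | ⟨-, -, h3⟩
    · exact h2 (h ▸ h1)
    · exact h1 (h.symm ▸ h2)
    · rw [h] at h3; exact lt_irrefl _ h3
  -- a bound above all weights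
  set N : ℕ := Finset.univ.sup σ + 1 with hN
  have hσN : ∀ q, σ q < N := fun q => Nat.lt_succ_of_le (Finset.le_sup (f := σ) (mem_univ q))
  -- the certificate data
  let pl : Fin k → Fin k → Bool := fun p _ => decide (p ∈ P)
  let rM : Fin k → Fin k → ℕ := fun p q => if p ∈ P then N + 1 else if q ∈ P then N else σ q
  let rΨ : Fin k → ℕ := fun _ => 0
  let rΦ : Fin k → ℕ := σ
  let a : Finset α → Fin k := fun X => if pl (i X) (j X) then i X else j X
  let b : Finset α → Fin k := fun X => if pl (i X) (j X) then j X else i X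
  -- the three kinds of bads
  have hkind : ∀ X ∈ D,
      (i X ∈ P ∧ j X ∉ P ∧ pl (i X) (j X) = true ∧ a X = i X ∧ b X = j X ∧ rM (i X) (j X) = N + 1) ∨
      (i X ∉ P ∧ j X ∈ P ∧ pl (i X) (j X) = false ∧ a X = j X ∧ b X = i X ∧ rM (i X) (j X) = N) ∨
      (i X ∉ P ∧ j X ∉ P ∧ σ (i X) < σ (j X) ∧ pl (i X) (j X) = false ∧ a X = j X ∧ b X = i X ∧
        rM (i X) (j X) = σ (j X)) := by
    intro X hX
    rcases hT X hX with ⟨hi, hj⟩ | ⟨hi, hj⟩ | ⟨hi, hj, hlt⟩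
    · left
      have hpl : pl (i X) (j X) = true := by simp only [pl, hi, decide_true]
      refine ⟨hi, hj, hpl, ?_, ?_, ?_⟩
      · show (if pl (i X) (j X) = true then i X else j X) = i X
        rw [if_pos hpl]
      · show (if pl (i X) (j X) = true then j X else i X) = j X
        rw [if_pos hpl]
      · show (if i X ∈ P then N + 1 else if j X ∈ P then N else σ (j X)) = N + 1
        rw [if_pos hi]
    · right; left
      have hpl : pl (i X) (j X) = false := by simp only [pl, hi, decide_false]
      have hnp : ¬ pl (i X) (j X) = true := by rw [hpl]; exact Bool.false_ne_true
      refine ⟨hi, hj, hpl, ?_, ?_, ?_⟩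
      · show (if pl (i X) (j X) = true then i X else j X) = j X
        rw [if_neg hnp]
      · show (if pl (i X) (j X) = true then j X else i X) = i X
        rw [if_neg hnp]
      · show (if i X ∈ P then N + 1 else if j X ∈ P then N else σ (j X)) = N
        rw [if_neg hi, if_pos hj]
    · right; right
      have hpl : pl (i X) (j X) = false := by simp only [pl, hi, decide_false]
      have hnp : ¬ pl (i X) (j X) = true := by rw [hpl]; exact Bool.false_ne_true
      refine ⟨hi, hj, hlt, hpl, ?_, ?_, ?_⟩
      · show (if pl (i X) (j X) = true then i X else j X) = j X
        rw [if_neg hnp]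
      · show (if pl (i X) (j X) = true then j X else i X) = i X
        rw [if_neg hnp]
      · show (if i X ∈ P then N + 1 else if j X ∈ P then N else σ (j X)) = σ (j X)
        rw [if_neg hi, if_neg hj]
  have hS₀ : ∀ q : Fin k, q ∈ univ \ P ↔ q ∉ P := fun q => by simp
  refine exists_injective_good_above_of_twoSidedCertCoInt S D (∅ : Finset (Fin k)) (univ \ P) hf i j hDS hDi hDj
    pl rM rΨ rΦ a b (fun _ _ => rfl) (fun _ _ => rfl) hij hco ?_ ?_ ?_
  · -- member / member
    intro X hX X' hX'
    rcases hkind X hX with ⟨hiX, hjX, hplX, haX, hbX, hrX⟩ | ⟨hiX, hjX, hplX, haX, hbX, hrX⟩ |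
        ⟨hiX, hjX, hltX, hplX, haX, hbX, hrX⟩ <;>
      rcases hkind X' hX' with ⟨hiX', hjX', hplX', haX', hbX', hrX'⟩ | ⟨hiX', hjX', hplX', haX', hbX', hrX'⟩ |
        ⟨hiX', hjX', hltX', hplX', haX', hbX', hrX'⟩ <;>
      rw [hrX, hrX', hplX, hplX', haX, hbX, haX', hbX'] <;>
      refine ⟨fun hle => ⟨fun h => ?_, ?_⟩, fun hlt => ?_⟩
    -- plain / plain
    · exact h
    · exact Or.inl ⟨fun h => hjX' (h ▸ hiX), fun h => hjX (h.symm ▸ hiX')⟩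
    · exact absurd hlt (lt_irrefl _)
    -- plain / comp-P
    · exact absurd hle (by omega)
    · exact absurd hle (by omega)
    · exact absurd hlt (by omega)
    -- plain / comp-up
    · exact absurd hle (by have := hσN (j X'); omega)
    · exact absurd hle (by have := hσN (j X'); omega)
    · exact absurd hlt (by have := hσN (j X'); omega)
    -- comp-P / plain
    · exact absurd h (by simp)
    · exact Or.inl ⟨fun h => hjX' (h ▸ hjX), fun h => hiX (h.symm ▸ hiX')⟩
    · exact Or.inr ⟨rfl, rfl⟩
    -- comp-P / comp-P
    · exact absurd h (by simp)
    · exact Or.inl ⟨fun h => hiX' (h ▸ hjX), fun h => hiX (h.symm ▸ hjX')⟩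
    · exact absurd hlt (lt_irrefl _)
    -- comp-P / comp-up
    · exact absurd hle (by have := hσN (j X'); omega)
    · exact absurd hle (by have := hσN (j X'); omega)
    · exact absurd hlt (by have := hσN (j X'); omega)
    -- comp-up / plain
    · exact absurd h (by simp)
    · by_cases hq : j X = j X'
      · exact Or.inr (Or.inr ⟨hq, fun h => hiX (h.symm ▸ hiX'), (hS₀ _).2 hjX⟩)
      · exact Or.inl ⟨hq, fun h => hiX (h.symm ▸ hiX')⟩
    · exact Or.inl fun h => hjX (h.1 ▸ hiX')
    -- comp-up / comp-P
    · exact absurd h (by simp)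
    · by_cases hq : j X = i X'
      · exact Or.inr (Or.inr ⟨hq, fun h => hiX (h.symm ▸ hjX'), (hS₀ _).2 hjX⟩)
      · exact Or.inl ⟨hq, fun h => hiX (h.symm ▸ hjX')⟩
    · exact Or.inl fun h => hjX (h.1 ▸ hjX')
    -- comp-up / comp-up
    · exact absurd h (by simp)
    · by_cases hq : j X = i X'
      · refine Or.inr (Or.inr ⟨hq, fun h => ?_, (hS₀ _).2 hjX⟩)
        rw [h] at hltX
        exact absurd (lt_of_lt_of_le hltX hle) (lt_irrefl _)
      · refine Or.inl ⟨hq, fun h => ?_⟩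
        rw [h] at hltX
        exact absurd (lt_of_lt_of_le hltX hle) (lt_irrefl _)
    · exact Or.inl fun h => by rw [h.1] at hlt; exact lt_irrefl _ hlt
  · -- member / Ψ : `R = ∅`
    intro X hX r hr
    exact absurd hr (by simp)
  · -- member / Φ_s
    intro X hX s hs
    have hsP : s ∉ P := (hS₀ s).1 hs
    show (rM (i X) (j X) ≤ σ s → _) ∧ (σ s < rM (i X) (j X) → _)
    rcases hkind X hX with ⟨hiX, hjX, hplX, haX, hbX, hrX⟩ | ⟨hiX, hjX, hplX, haX, hbX, hrX⟩ |
        ⟨hiX, hjX, hltX, hplX, haX, hbX, hrX⟩ <;>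
      rw [hrX, hplX, haX, hbX] <;> refine ⟨fun hle => ?_, fun hlt => ?_⟩
    · exact absurd hle (by have := hσN s; omega)
    · exact fun h => hsP (h ▸ hiX)
    · exact absurd hle (by have := hσN s; omega)
    · exact fun h => hsP (h ▸ hjX)
    · refine ⟨rfl, fun h => ?_, (hS₀ _).2 hjX⟩
      rw [h] at hltX
      exact absurd (lt_of_lt_of_le hltX hle) (lt_irrefl _)
    · exact fun h => by rw [h] at hlt; exact lt_irrefl _ hlt

/-- **Opposite-free form of the bipartite-acyclic theorem** (for prim-ineq-gen-3's Conjecture O_k).  If no two bads of `D` have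
opposite types, co-intersection is automatic (`union_ne_of_oppositeFree`), so: petals `P ⊔ Q`, every type of `D` an arc between
`P` and `Q` or an arc inside `Q` going up in `σ` ⟹ distinct good representatives.  Exhaustively (memo
`prim-hp-7/FROM-prim-hp-7-g54-THREE-PETALS.md` (S8), `code/gen54/lab54/of5.py`): every opposite-free type class on at most five
petals satisfies this hypothesis for some `P, σ`, EXCEPT the bipartite ones (covered with `Q`-arcs empty after moving one colour
class to `P` — also an instance) and exactly three ten-type tournament classes on five petals, prim-ineq-gen-3's open classes
`open1/2/3`; i.e. this single statement has the reach 6/6, 41/41, 578/581 of their label-level table, uniformly in `k`.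
[this work] -/
theorem exists_injective_good_above_of_oppositeFree_bipartiteAcyclic (S : Finset α) {f : Finset α → Lab k}
    (hf : ∀ ⦃X Y : Finset α⦄, X ⊆ Y → f X ≤ f Y) (D : Finset (Finset α)) (i j : Finset α → Fin k)
    (hDS : ∀ X ∈ D, X ⊆ S) (hDi : ∀ X ∈ D, f X = petal (i X)) (hDj : ∀ X ∈ D, f (S \ X) = petal (j X))
    (P : Finset (Fin k)) (σ : Fin k → ℕ)
    (hT : ∀ X ∈ D, (i X ∈ P ∧ j X ∉ P) ∨ (i X ∉ P ∧ j X ∈ P) ∨ (i X ∉ P ∧ j X ∉ P ∧ σ (i X) < σ (j X)))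
    (hOpp : ∀ X ∈ D, ∀ X' ∈ D, ¬ (i X = j X' ∧ j X = i X')) :
    ∃ φ : D → Finset α, Function.Injective φ ∧
      ∀ X : D, (X : Finset α) ⊆ φ X ∧ φ X ⊆ S ∧ f (φ X) = top ∧ f (S \ φ X) = bot :=
  exists_injective_good_above_of_coint_bipartiteAcyclic S hf D i j hDS hDi hDj P σ hT
    (union_ne_of_oppositeFree S hf D i j hDi hDj hOpp)

end OrientedAntipodalHall

end Summit.CriticalPhenomena.PercolationContinuityZ3.Theorems
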